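import Summits.AtomisticToContinuum.HydrodynamicLimit.Theorems.EquilibriumFastWindowLD.Negative.ConservedWindowSums
import Summits.AtomisticToContinuum.HydrodynamicLimit.Theorems.TwoClocksEquilibriumShearWindowLDCentring

/-!
# `EquilibriumFastWindowLD` — negative knowledge (b.3): the ENERGY-SHELL FLOOR of the window pressure

Support file for crux `stmt-AtomisticToContinuum-14440` (`TwoClocks.EquilibriumFastWindowLD`), written by the
standing disprover (cdisprove seat). Def-free. The energy shells `{E = const}` are exactly invariant under every
hard-sphere flow, and the global Gibbs law at temperature `θ` has the explicit density
`θ^{-3(N+1)/2} e^{-(1/θ - 1)E(z)}` with respect to the one at temperature `1` (same positions factor, same partition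
function: `canonicalPartition_eq_posPartition`). Changing the reference temperature and applying Jensen under
`G_N^{(θ)}` (where the window functional of a VELOCITY observable `g` has mean `(N+1) w ∫ g dN(0,θ)` by stationarity,
`integral_window_integral_eq`) gives, for EVERY `σ ≤ 1/2`, flow, window, `N`, tilt `β` and temperature `θ > 0`:

* `shellFloor` — `exp((N+1)[β m_θ(g) − (3/2)(θ − 1 − log θ)]) ≤ ∫ exp(β Σᵢ w⁻¹∫₀ʷ g(vᵢ(r)) dr) dG_N`,
  `m_θ(g) = ∫ g dN(0, θ·id)` — the Gibbs variational floor of the `(E)`-shell at temperature `θ` (gain `β m_θ(g)`,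
  price the specific relative entropy `I(θ) = (3/2)(θ − 1 − log θ)` of `N(0,θ)` w.r.t. `N(0,1)`), uniform in the window:
  time averaging never touches it;
* `beta_mul_mean_le_relEntropy_of_windowDecay` — hence the crux's conclusion for `g` (at `θ₀ = 1`, `u₀ = 0`) FORCES
  `β m_θ(g) ≤ I(θ)` for every `|β| ≤ β₀` and every `θ > 0`, i.e. `β₀ ≤ β*_E(g) := inf_θ I(θ)/|m_θ(g)|`. For admissible
  `g` (`⊥ 1, v, |v|²`) `m_θ(g) = O((θ−1)²)` near `θ = 1` while `I(θ) ≈ (3/4)(θ−1)²`, so `β*_E(g) > 0` — consistent with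
  `∃ β₀` — but FINITE: the τ-independent β-ceiling from the quadratic equation-of-state response, as a theorem
  (the batch refuter's remark; `Negative/BetaCeiling.lean` is its `θ → ∞` end, where the floor becomes `+∞`).

All `[folklore]`.
-/

noncomputable section

open MeasureTheory ProbabilityTheory Real Set
open scoped ENNReal

namespace Summit.AtomisticToContinuum.HydrodynamicLimit.Theorems.EquilibriumFastWindowLDNegative

open Literature.Analysis.FluidPDE Literature.MathematicalPhysics.KineticTheory
open Summit.AtomisticToContinuum.HydrodynamicLimit.Theorems.CorrectorPressureDecayNegative

/-! ## One-body velocity marginals of the global Gibbs law -/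

/-- **One-body velocity marginal, `lintegral` form**: under the constant-profile Gibbs law the velocity of particle
`i` is `N(u, θ·id)`: `∫⁻ f(vᵢ) dG_N = ∫⁻ f dN(u,θ)` (disintegration `lintegral_localGibbsMeasure`). [folklore] -/
theorem lintegral_vel_localGibbsLaw_const {a θ : ℝ} (ha : 0 < a) (hθ : 0 < θ) (u : V3) {σ : ℝ} (hσ2 : σ ≤ 1 / 2)
    (N : ℕ) (Φ : HardSphereFlow (Torus.geometry (Fin 3)) (hsDiameter σ N) (N + 1)) (i : Fin (N + 1))
    {f : V3 → ℝ≥0∞} (hf : Measurable f) :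
    ∫⁻ z, f (z i).2 ∂(localGibbsLaw σ (fun _ => a) (fun _ => u) (fun _ => θ) N Φ) = ∫⁻ w, f w ∂(gaussMeasure u θ) := by
  haveI := isProbabilityMeasure_localGibbsMeasure (a₀ := fun _ => a) (u₀ := fun _ => u) (θ₀ := fun _ => θ)
    continuous_const continuous_const continuous_const (fun _ => ha) (fun _ => hθ) hσ2 N
  have hG : Measurable fun z : Config (N + 1) (Fin 3) T3 => f (z i).2 := hf.comp (measurable_pi_apply i).snd
  rw [localGibbsLaw_eq, lintegral_localGibbsMeasure continuous_const continuous_const continuous_const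
    (fun _ => ha.le) (fun _ => hθ) σ N hG]
  have hinner : ∀ x : Fin (N + 1) → T3,
      ∫⁻ v, f (zipConfig (x, v) i).2 ∂velMeasure (fun _ => u) (fun _ => θ) x = ∫⁻ w, f w ∂(gaussMeasure u θ) := by
    intro x
    simp only [zipConfig_apply]
    exact (measurePreserving_eval (fun _ : Fin (N + 1) => gaussMeasure u θ) i).lintegral_comp hf
  simp_rw [hinner]
  rw [lintegral_mul_const _ (by
      exact (measurable_const.mul (measurable_posWeight continuous_const _ _)).ennreal_ofReal),
    lintegral_posWeight_eq_one continuous_const continuous_const continuous_const (fun _ => ha.le)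
      (fun _ => hθ) σ N, one_mul]

/-- A velocity observable of quadratic growth is integrable under the constant-profile Gibbs law. [folklore] -/
theorem integrable_vel_localGibbsLaw_const {a θ : ℝ} (ha : 0 < a) (hθ : 0 < θ) (u : V3) {σ : ℝ} (hσ2 : σ ≤ 1 / 2)
    (N : ℕ) (Φ : HardSphereFlow (Torus.geometry (Fin 3)) (hsDiameter σ N) (N + 1)) (i : Fin (N + 1))
    {g : V3 → ℝ} (hg : Measurable g) {C : ℝ} (hC : ∀ v, |g v| ≤ C * (1 + ‖v‖ ^ 2)) :
    Integrable (fun z : Config (N + 1) (Fin 3) T3 => g (z i).2)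
      (localGibbsLaw σ (fun _ => a) (fun _ => u) (fun _ => θ) N Φ) := by
  haveI : IsProbabilityMeasure (localGibbsLaw σ (fun _ => a) (fun _ => u) (fun _ => θ) N Φ) :=
    isProbabilityMeasure_localGibbsLaw (a₀ := fun _ => a) (θ₀ := fun _ => θ) (u₀ := fun _ => u)
      continuous_const continuous_const continuous_const (fun _ => ha) (fun _ => hθ) hσ2 N Φ
  have hC0 : 0 ≤ C := growthConst_nonneg (F := fun y : T3 × V3 => g y.2) (fun y => hC y.2)
  have hdom : Integrable (fun z : Config (N + 1) (Fin 3) T3 => C * (1 + 2 * configEnergy z))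
      (localGibbsLaw σ (fun _ => a) (fun _ => u) (fun _ => θ) N Φ) :=
    ((integrable_const (1 : ℝ)).add
      ((integrable_configEnergy_localGibbsLaw_const ha hθ u hσ2 N Φ).const_mul 2)).const_mul C
  refine hdom.mono' (hg.comp (measurable_pi_apply i).snd).aestronglyMeasurable (ae_of_all _ fun z => ?_)
  rw [Real.norm_eq_abs]
  refine (hC _).trans (mul_le_mul_of_nonneg_left ?_ hC0)
  linarith [norm_vel_sq_le_two_mul_configEnergy z i]

/-- A velocity observable of quadratic growth is integrable under `N(u, θ·id)`. [folklore] -/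
theorem integrable_gaussMeasure_of_growth (θ : ℝ) (u : V3) {g : V3 → ℝ} (hg : Measurable g) {C : ℝ}
    (hC : ∀ v, |g v| ≤ C * (1 + ‖v‖ ^ 2)) : Integrable g (gaussMeasure u θ) := by
  have h0 : Integrable (fun v : V3 => ‖v‖ ^ 2 / 2 - 0) (gaussMeasure u θ) :=
    (memLp_energy_gaussMeasure (ι := Fin 3) u θ 0).integrable one_le_two
  have h2 : Integrable (fun v : V3 => ‖v‖ ^ 2) (gaussMeasure u θ) :=
    (h0.const_mul 2).congr (ae_of_all _ fun v => by simp only [sub_zero]; ring)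
  refine (((integrable_const (1 : ℝ)).add h2).const_mul C).mono' hg.aestronglyMeasurable (ae_of_all _ fun v => ?_)
  rw [Real.norm_eq_abs]
  exact hC v

/-- **One-body velocity marginal, Bochner form**: for `g` measurable of quadratic growth,
`∫ g(vᵢ) dG_N = ∫ g dN(u,θ)`. [folklore] -/
theorem integral_vel_localGibbsLaw_const {a θ : ℝ} (ha : 0 < a) (hθ : 0 < θ) (u : V3) {σ : ℝ} (hσ2 : σ ≤ 1 / 2)
    (N : ℕ) (Φ : HardSphereFlow (Torus.geometry (Fin 3)) (hsDiameter σ N) (N + 1)) (i : Fin (N + 1))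
    {g : V3 → ℝ} (hg : Measurable g) {C : ℝ} (hC : ∀ v, |g v| ≤ C * (1 + ‖v‖ ^ 2)) :
    ∫ z, g (z i).2 ∂(localGibbsLaw σ (fun _ => a) (fun _ => u) (fun _ => θ) N Φ) = ∫ w, g w ∂(gaussMeasure u θ) := by
  have hI := integrable_vel_localGibbsLaw_const ha hθ u hσ2 N Φ i hg hC
  have hJ := integrable_gaussMeasure_of_growth θ u hg hC
  rw [integral_eq_lintegral_pos_part_sub_lintegral_neg_part hI,
    integral_eq_lintegral_pos_part_sub_lintegral_neg_part hJ,
    lintegral_vel_localGibbsLaw_const ha hθ u hσ2 N Φ i (f := fun w => ENNReal.ofReal (g w)) hg.ennreal_ofReal,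
    lintegral_vel_localGibbsLaw_const ha hθ u hσ2 N Φ i (f := fun w => ENNReal.ofReal (-g w)) hg.neg.ennreal_ofReal]

/-- `∫ ‖v‖² dN(0, θ·id) = 3θ` on `ℝ³`. [folklore] -/
theorem integral_normSq_gaussMeasure {θ : ℝ} (hθ : 0 < θ) : ∫ v, ‖v‖ ^ 2 ∂(gaussMeasure (0 : V3) θ) = 3 * θ := by
  rw [integral_gaussMeasure (0 : V3) hθ]
  simp only [zero_add, norm_smul, mul_pow, Real.norm_eq_abs, abs_of_nonneg (Real.sqrt_nonneg θ),
    Real.sq_sqrt hθ.le]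
  rw [integral_const_mul, integral_norm_sq_stdGaussian]
  simp
  ring

/-- **Mean kinetic energy under the Gibbs law at rest**: `∫ E dG_N = (3/2) θ (N+1)`. [folklore] -/
theorem integral_configEnergy_localGibbsLaw_const {a θ : ℝ} (ha : 0 < a) (hθ : 0 < θ) {σ : ℝ} (hσ2 : σ ≤ 1 / 2)
    (N : ℕ) (Φ : HardSphereFlow (Torus.geometry (Fin 3)) (hsDiameter σ N) (N + 1)) :
    ∫ z, configEnergy z ∂(localGibbsLaw σ (fun _ => a) (fun _ => 0) (fun _ => θ) N Φ) = 3 / 2 * θ * ((N : ℝ) + 1) := by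
  have hg : Measurable fun v : V3 => ‖v‖ ^ 2 := measurable_norm.pow_const 2
  have hC : ∀ v : V3, |‖v‖ ^ 2| ≤ 1 * (1 + ‖v‖ ^ 2) := fun v => by
    rw [abs_of_nonneg (sq_nonneg _)]; linarith
  have hi : ∀ i : Fin (N + 1), ∫ z, ‖(z i).2‖ ^ 2 ∂(localGibbsLaw σ (fun _ => a) (fun _ => 0) (fun _ => θ) N Φ) =
      3 * θ := fun i => by
    rw [integral_vel_localGibbsLaw_const ha hθ 0 hσ2 N Φ i hg hC, integral_normSq_gaussMeasure hθ]
  simp only [configEnergy]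
  rw [integral_const_mul, integral_finsetSum _ (fun i _ =>
    integrable_vel_localGibbsLaw_const ha hθ 0 hσ2 N Φ i hg hC)]
  simp_rw [hi]
  simp [Finset.sum_const, Finset.card_univ, Fintype.card_fin]
  ring

/-! ## Change of the reference temperature -/

/-- The velocity factors of the constant-profile Gibbs densities at temperatures `θ` and `1` differ by
`θ^{-3n/2} e^{-(θ⁻¹-1)E}`. [folklore] -/
theorem gibbsVelFactor_temperature (a : ℝ) {θ : ℝ} (hθ : 0 < θ) (n : ℕ) (E : ℝ) :
    (a * (2 * Real.pi * θ) ^ (-(3 : ℝ) / 2)) ^ n * Real.exp (-E / θ) =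
      (a * (2 * Real.pi * 1) ^ (-(3 : ℝ) / 2)) ^ n * Real.exp (-E / 1) *
        (θ ^ (-(3 : ℝ) * (n : ℝ) / 2) * Real.exp (-(θ⁻¹ - 1) * E)) := by
  have h2π : (0 : ℝ) ≤ 2 * Real.pi := by positivity
  have hθn : (θ ^ (-(3 : ℝ) / 2)) ^ n = θ ^ (-(3 : ℝ) * (n : ℝ) / 2) := by
    rw [← Real.rpow_natCast, ← Real.rpow_mul hθ.le]
    congr 1
    ring
  have hexp : Real.exp (-E / θ) = Real.exp (-E / 1) * Real.exp (-(θ⁻¹ - 1) * E) := by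
    rw [← Real.exp_add]
    congr 1
    field_simp
    ring
  rw [mul_one, Real.mul_rpow h2π hθ.le, ← mul_assoc a, mul_pow, hθn, hexp]
  ring

/-- **The Gibbs law at temperature `θ` has density `θ^{-3(N+1)/2} e^{-(θ⁻¹ - 1)E}` w.r.t. the one at temperature `1`**
(same activity, at rest; the positions factor and the partition function coincide,
`canonicalPartition_eq_posPartition`). [folklore] -/
theorem localGibbsLaw_temperature_eq_withDensity {a θ : ℝ} (ha : 0 < a) (hθ : 0 < θ) {σ : ℝ} (N : ℕ)
    (Φ : HardSphereFlow (Torus.geometry (Fin 3)) (hsDiameter σ N) (N + 1)) :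
    localGibbsLaw σ (fun _ => a) (fun _ => 0) (fun _ => θ) N Φ =
      (localGibbsLaw σ (fun _ => a) (fun _ => 0) (fun _ => 1) N Φ).withDensity fun z =>
        ENNReal.ofReal (θ ^ (-(3 : ℝ) * ((N : ℝ) + 1) / 2) * Real.exp (-(θ⁻¹ - 1) * configEnergy z)) := by
  set L := liouville (Torus.geometry (Fin 3)) (N + 1) (hsDiameter σ N) with hL
  set ρ : ℝ → Config (N + 1) (Fin 3) T3 → ℝ := fun t z => canonicalDensity (Torus.geometry (Fin 3)) (hsDiameter σ N)
    (N + 1) (localGibbsProfile (fun _ => a) (fun _ => (0 : V3)) (fun _ => t)) z with hρ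
  set r : Config (N + 1) (Fin 3) T3 → ℝ := fun z =>
    θ ^ (-(3 : ℝ) * ((N : ℝ) + 1) / 2) * Real.exp (-(θ⁻¹ - 1) * configEnergy z) with hr
  have hG : ∀ t : ℝ, localGibbsLaw σ (fun _ => a) (fun _ => 0) (fun _ => t) N Φ =
      L.withDensity (fun z => ENNReal.ofReal (ρ t z)) := fun t => rfl
  have hρm : ∀ t : ℝ, Measurable fun z => ENNReal.ofReal (ρ t z) := fun t =>
    (measurable_canonicalDensity _ _ (measurable_localGibbsProfile continuous_const continuous_const
      continuous_const)).ennreal_ofReal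
  have hrm : Measurable fun z => ENNReal.ofReal (r z) := by
    have := measurable_configEnergy (N + 1)
    simp only [hr]
    fun_prop
  -- the two partition functions coincide
  have hZ : ∀ t : ℝ, 0 < t → canonicalPartition (Torus.geometry (Fin 3)) (hsDiameter σ N) (N + 1)
      (localGibbsProfile (fun _ => a) (fun _ => (0 : V3)) (fun _ => t)) = posPartition (fun _ => a) (hsDiameter σ N) (N + 1) :=
    fun t ht => canonicalPartition_eq_posPartition continuous_const continuous_const continuous_const
      (fun _ => ha.le) (fun _ => ht) _ _
  -- pointwise identity of the densities
  have hpt : ∀ z, ρ θ z = ρ 1 z * r z := by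
    intro z
    show canonicalDensity _ _ _ _ z = canonicalDensity _ _ _ _ z * r z
    unfold canonicalDensity
    rw [hZ θ hθ, hZ 1 one_pos]
    by_cases hz : z ∈ hardSphereDomain (Torus.geometry (Fin 3)) (N + 1) (hsDiameter σ N)
    · rw [indicator_of_mem hz, indicator_of_mem hz, CorrectorPressureDecayNegative.tensorPow_localGibbsProfile_const,
        CorrectorPressureDecayNegative.tensorPow_localGibbsProfile_const,
        gibbsVelFactor_temperature a hθ (N + 1) (configEnergy z), hr]
      push_cast
      ring
    · rw [indicator_of_notMem hz, indicator_of_notMem hz]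
      simp
  have hρ1 : ∀ z, 0 ≤ ρ 1 z := fun z => by
    show 0 ≤ canonicalDensity _ _ _ _ z
    unfold canonicalDensity
    refine mul_nonneg (inv_nonneg.2 (canonicalPartition_nonneg _ _ _
      (localGibbsProfile_nonneg (fun _ => ha.le) fun _ => zero_le_one))) ?_
    exact Set.indicator_nonneg (fun w _ => tensorPow_nonneg
      (localGibbsProfile_nonneg (fun _ => ha.le) fun _ => zero_le_one) _ w) z
  rw [hG θ, hG 1, ← withDensity_mul _ (hρm 1) hrm]
  congr 1
  funext z
  rw [Pi.mul_apply, hpt z, ENNReal.ofReal_mul (hρ1 z)]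

/-- **Exponential moments at temperature `1` are temperature-`θ` moments of the re-weighted observable**:
`∫⁻ e^{Y} dG_N^{(1)} = θ^{3(N+1)/2} ∫⁻ e^{Y + (θ⁻¹ - 1)E} dG_N^{(θ)}`. [folklore] -/
theorem lintegral_exp_eq_temperature {a θ : ℝ} (ha : 0 < a) (hθ : 0 < θ) {σ : ℝ} (N : ℕ)
    (Φ : HardSphereFlow (Torus.geometry (Fin 3)) (hsDiameter σ N) (N + 1)) (Y : Config (N + 1) (Fin 3) T3 → ℝ) :
    ∫⁻ z, ENNReal.ofReal (Real.exp (Y z)) ∂(localGibbsLaw σ (fun _ => a) (fun _ => 0) (fun _ => 1) N Φ) =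
      ENNReal.ofReal (θ ^ ((3 : ℝ) * ((N : ℝ) + 1) / 2)) *
        ∫⁻ z, ENNReal.ofReal (Real.exp (Y z + (θ⁻¹ - 1) * configEnergy z))
          ∂(localGibbsLaw σ (fun _ => a) (fun _ => 0) (fun _ => θ) N Φ) := by
  have hrm : Measurable fun z : Config (N + 1) (Fin 3) T3 =>
      ENNReal.ofReal (θ ^ (-(3 : ℝ) * ((N : ℝ) + 1) / 2) * Real.exp (-(θ⁻¹ - 1) * configEnergy z)) := by
    have := measurable_configEnergy (N + 1)
    fun_prop
  rw [localGibbsLaw_temperature_eq_withDensity ha hθ N Φ, ← lintegral_const_mul' _ _ ENNReal.ofReal_ne_top,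
    lintegral_withDensity_eq_lintegral_mul_non_measurable _ hrm (ae_of_all _ fun _ => ENNReal.ofReal_lt_top)]
  refine lintegral_congr fun z => ?_
  have hθp : 0 < θ ^ ((3 : ℝ) * ((N : ℝ) + 1) / 2) := Real.rpow_pos_of_pos hθ _
  simp only [Pi.mul_apply]
  rw [← ENNReal.ofReal_mul hθp.le, ← ENNReal.ofReal_mul (by positivity)]
  congr 1
  rw [Real.exp_add, show ∀ p e3 q e1 e2 : ℝ, p * e3 * (q * (e1 * e2)) = (p * q) * (e1 * (e2 * e3)) from
    fun _ _ _ _ _ => by ring, ← Real.rpow_add hθ, ← Real.exp_add, ← Real.exp_add]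
  have h0 : -(3 : ℝ) * ((N : ℝ) + 1) / 2 + 3 * ((N : ℝ) + 1) / 2 = 0 := by ring
  rw [h0, Real.rpow_zero, one_mul]
  congr 1
  ring

/-! ## The window functional of a velocity observable: integrability and mean under `G_N^{(θ)}` -/

/-- **The window functional is integrable and has the static mean**: for `g` continuous of quadratic growth, under
the Gibbs law at rest at temperature `θ`, `z ↦ Σᵢ w⁻¹∫₀ʷ g(vᵢ(r)) dr` is integrable with integral
`(N+1) ∫ g dN(0,θ)`. [folklore] -/
theorem integrable_windowSum_and_integral_eq {a θ : ℝ} (ha : 0 < a) (hθ : 0 < θ) {σ : ℝ} (hσ2 : σ ≤ 1 / 2) (N : ℕ)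
    (Φ : HardSphereFlow (Torus.geometry (Fin 3)) (hsDiameter σ N) (N + 1)) {g : V3 → ℝ} (hg : Continuous g) {C : ℝ}
    (hC : ∀ v, |g v| ≤ C * (1 + ‖v‖ ^ 2)) {w : ℝ} (hw : 0 < w) :
    Integrable (fun z : Config (N + 1) (Fin 3) T3 => ∑ i, w⁻¹ * ∫ r in (0 : ℝ)..w, g (Φ.flow r z i).2)
      (localGibbsLaw σ (fun _ => a) (fun _ => 0) (fun _ => θ) N Φ) ∧
    ∫ z, (∑ i, w⁻¹ * ∫ r in (0 : ℝ)..w, g (Φ.flow r z i).2)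
      ∂(localGibbsLaw σ (fun _ => a) (fun _ => 0) (fun _ => θ) N Φ) = ((N : ℝ) + 1) * ∫ v, g v ∂(gaussMeasure (0 : V3) θ) := by
  set μ := localGibbsLaw σ (fun _ => a) (fun _ => 0) (fun _ => θ) N Φ with hμ
  haveI : IsProbabilityMeasure μ := isProbabilityMeasure_localGibbsLaw (a₀ := fun _ => a)
    (θ₀ := fun _ => θ) (u₀ := fun _ => (0 : V3)) continuous_const continuous_const continuous_const
    (fun _ => ha) (fun _ => hθ) hσ2 N Φ
  have hF : Continuous fun y : T3 × V3 => g y.2 := hg.comp continuous_snd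
  have hCF : ∀ y : T3 × V3, |g y.2| ≤ C * (1 + ‖y.2‖ ^ 2) := fun y => hC y.2
  have hC0 : 0 ≤ C := growthConst_nonneg hCF
  have hae : ∀ᵐ z ∂μ, z ∈ Φ.good := mem_ae_iff.2 (localGibbsLaw_const_compl_good σ a θ 0 N Φ)
  -- each window integral is bounded by the integrable `w C (1 + 2E)` on the good set, and measurable
  have hint : ∀ i : Fin (N + 1), Integrable (fun z => w⁻¹ * ∫ r in (0 : ℝ)..w, g (Φ.flow r z i).2) μ := by
    intro i
    have hdom : Integrable (fun z : Config (N + 1) (Fin 3) T3 => w⁻¹ * (w * (C * (1 + 2 * configEnergy z)))) μ :=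
      ((((integrable_const (1 : ℝ)).add
        ((integrable_configEnergy_localGibbsLaw_const ha hθ 0 hσ2 N Φ).const_mul 2)).const_mul C).const_mul
        w).const_mul w⁻¹
    -- measurability: the window integral is the `ν`-integral of a jointly a.e.-measurable, integrable map
    set ν : Measure ℝ := volume.restrict (Ioc (0 : ℝ) w) with hν
    haveI : IsFiniteMeasure ν := by rw [hν]; exact isFiniteMeasure_restrict.2 (by simp)
    have hgi : Measurable fun z : Config (N + 1) (Fin 3) T3 => g (z i).2 :=
      hg.measurable.comp (measurable_pi_apply i).snd
    have hm : AEStronglyMeasurable (Function.uncurry fun (z : Config (N + 1) (Fin 3) T3) (r : ℝ) =>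
        g (Φ.flow r z i).2) (μ.prod ν) :=
      (aemeasurable_comp_flow_prod Φ (localGibbsLaw_const_compl_good σ a θ 0 N Φ) ν (0 : ℝ) hgi).aestronglyMeasurable
    have hdomP : Integrable (fun p : Config (N + 1) (Fin 3) T3 × ℝ => C * (1 + 2 * configEnergy p.1)) (μ.prod ν) :=
      (((integrable_const (1 : ℝ)).add
        ((integrable_configEnergy_localGibbsLaw_const ha hθ 0 hσ2 N Φ).const_mul 2)).const_mul C).comp_fst ν
    have haeP : ∀ᵐ p ∂(μ.prod ν), p.1 ∈ Φ.good := (Measure.quasiMeasurePreserving_fst (μ := μ) (ν := ν)).ae hae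
    have hintP : Integrable (Function.uncurry fun (z : Config (N + 1) (Fin 3) T3) (r : ℝ) => g (Φ.flow r z i).2)
        (μ.prod ν) := by
      refine hdomP.mono' hm ?_
      filter_upwards [haeP] with p hp
      change ‖g (Φ.flow p.2 p.1 i).2‖ ≤ _
      rw [Real.norm_eq_abs]
      refine (hC _).trans (mul_le_mul_of_nonneg_left ?_ hC0)
      linarith [norm_vel_flow_sq_le Φ hp p.2 i]
    have hmeas : AEStronglyMeasurable (fun z => w⁻¹ * ∫ r in (0 : ℝ)..w, g (Φ.flow r z i).2) μ := by
      have h1 : AEStronglyMeasurable (fun z => ∫ r, g (Φ.flow r z i).2 ∂ν) μ :=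
        hintP.integral_prod_left.aestronglyMeasurable
      have h2 : (fun z => w⁻¹ * ∫ r in (0 : ℝ)..w, g (Φ.flow r z i).2) =
          fun z => w⁻¹ * ∫ r, g (Φ.flow r z i).2 ∂ν := by
        funext z; rw [intervalIntegral.integral_of_le hw.le, hν]
      rw [h2]
      exact h1.const_mul _
    refine hdom.mono' hmeas ?_
    filter_upwards [hae] with z hz
    rw [Real.norm_eq_abs, abs_mul, abs_of_pos (inv_pos.2 hw)]
    exact mul_le_mul_of_nonneg_left (abs_window_integral_le Φ hz hCF hw.le i) (inv_nonneg.2 hw.le)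
  refine ⟨integrable_finsetSum _ fun i _ => hint i, ?_⟩
  rw [integral_finsetSum _ fun i _ => hint i]
  have hi : ∀ i : Fin (N + 1), ∫ z, (w⁻¹ * ∫ r in (0 : ℝ)..w, g (Φ.flow r z i).2) ∂μ =
      ∫ v, g v ∂(gaussMeasure (0 : V3) θ) := by
    intro i
    rw [integral_const_mul]
    have h := integral_window_integral_eq ha hθ 0 hσ2 N Φ hF hCF i hw.le
    rw [hμ, h, ← mul_assoc, inv_mul_cancel₀ hw.ne', one_mul,
      integral_vel_localGibbsLaw_const ha hθ 0 hσ2 N Φ i hg.measurable hC]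
  simp_rw [hi]
  simp [Finset.sum_const, Finset.card_univ, Fintype.card_fin]

/-! ## The shell floor -/

/-- **(b.3) The energy-shell floor of the window pressure.** For the global Gibbs law at rest with `θ₀ = 1`
(`a₀ > 0`, `σ ≤ 1/2`), every flow, window `w > 0`, `N`, tilt `β`, continuous `g` of quadratic growth and every
temperature `θ > 0`:
`exp((N+1)[β ∫ g dN(0,θ) − (3/2)(θ − 1 − log θ)]) ≤ ∫ exp(β Σᵢ w⁻¹∫₀ʷ g(vᵢ(r)) dr) dG_N`. [folklore] -/
theorem shellFloor {a₀ : ℝ} (ha : 0 < a₀) {σ : ℝ} (hσ2 : σ ≤ 1 / 2) (N : ℕ)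
    (Φ : HardSphereFlow (Torus.geometry (Fin 3)) (hsDiameter σ N) (N + 1)) {g : V3 → ℝ} (hg : Continuous g) {C : ℝ}
    (hC : ∀ v, |g v| ≤ C * (1 + ‖v‖ ^ 2)) (β : ℝ) {θ : ℝ} (hθ : 0 < θ) {w : ℝ} (hw : 0 < w) :
    ENNReal.ofReal (Real.exp (((N : ℝ) + 1) *
        (β * ∫ v, g v ∂(gaussMeasure (0 : V3) θ) - 3 / 2 * (θ - 1 - Real.log θ)))) ≤
      ∫⁻ z, ENNReal.ofReal (Real.exp (β * ∑ i : Fin (N + 1), w⁻¹ * ∫ r in (0 : ℝ)..w, g (Φ.flow r z i).2))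
        ∂(localGibbsLaw σ (fun _ => a₀) (fun _ => 0) (fun _ => 1) N Φ) := by
  set μθ := localGibbsLaw σ (fun _ => a₀) (fun _ => 0) (fun _ => θ) N Φ with hμθ
  haveI : IsProbabilityMeasure μθ := isProbabilityMeasure_localGibbsLaw (a₀ := fun _ => a₀)
    (θ₀ := fun _ => θ) (u₀ := fun _ => (0 : V3)) continuous_const continuous_const continuous_const
    (fun _ => ha) (fun _ => hθ) hσ2 N Φ
  obtain ⟨hWint, hWmean⟩ := integrable_windowSum_and_integral_eq ha hθ hσ2 N Φ hg hC hw
  set Z : Config (N + 1) (Fin 3) T3 → ℝ := fun z =>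
    β * (∑ i : Fin (N + 1), w⁻¹ * ∫ r in (0 : ℝ)..w, g (Φ.flow r z i).2) + (θ⁻¹ - 1) * configEnergy z with hZ
  have hZint : Integrable Z μθ :=
    (hWint.const_mul β).add ((integrable_configEnergy_localGibbsLaw_const ha hθ 0 hσ2 N Φ).const_mul _)
  have hZmean : ∫ z, Z z ∂μθ = ((N : ℝ) + 1) * (β * ∫ v, g v ∂(gaussMeasure (0 : V3) θ) + 3 / 2 * (1 - θ)) := by
    rw [hZ, integral_add (hWint.const_mul β) ((integrable_configEnergy_localGibbsLaw_const ha hθ 0 hσ2 N Φ).const_mul _),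
      integral_const_mul, integral_const_mul, hWmean, integral_configEnergy_localGibbsLaw_const ha hθ hσ2 N Φ]
    have hθ0 : θ ≠ 0 := hθ.ne'
    have key : (θ⁻¹ - 1) * θ = 1 - θ := by rw [sub_mul, inv_mul_cancel₀ hθ0, one_mul]
    linear_combination (3 / 2 * ((N : ℝ) + 1)) * key
  -- change the reference temperature, then Jensen under `μθ`
  rw [lintegral_exp_eq_temperature ha hθ N Φ]
  have hJ := KineticFluxLdDecayTilt.ofReal_exp_integral_le_lintegral μθ hZint
  rw [hZmean] at hJ
  calc ENNReal.ofReal (Real.exp (((N : ℝ) + 1) * (β * ∫ v, g v ∂(gaussMeasure (0 : V3) θ) - 3 / 2 * (θ - 1 - Real.log θ))))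
      = ENNReal.ofReal (θ ^ ((3 : ℝ) * ((N : ℝ) + 1) / 2)) *
          ENNReal.ofReal (Real.exp (((N : ℝ) + 1) * (β * ∫ v, g v ∂(gaussMeasure (0 : V3) θ) + 3 / 2 * (1 - θ)))) := by
        rw [← ENNReal.ofReal_mul (Real.rpow_nonneg hθ.le _), Real.rpow_def_of_pos hθ, ← Real.exp_add]
        congr 2
        ring
    _ ≤ ENNReal.ofReal (θ ^ ((3 : ℝ) * ((N : ℝ) + 1) / 2)) * ∫⁻ z, ENNReal.ofReal (Real.exp (Z z)) ∂μθ :=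
        mul_le_mul' le_rfl hJ

/-- **(b.3′) The `(E)`-shell β-ceiling**: if the crux's conclusion holds for the velocity observable `g` (at
`θ₀ = 1`, `u₀ = 0`, some `σ ≤ 1/2`, `a₀ > 0`, some flow family) at the tilt `β`, then
`β ∫ g dN(0,θ) ≤ (3/2)(θ − 1 − log θ)` for EVERY `θ > 0`. [folklore] -/
theorem beta_mul_mean_le_relEntropy_of_windowDecay {a₀ : ℝ} (ha : 0 < a₀) {σ : ℝ} (hσ2 : σ ≤ 1 / 2)
    (Φ : (N : ℕ) → HardSphereFlow (Torus.geometry (Fin 3)) (hsDiameter σ N) (N + 1)) {g : V3 → ℝ} (hg : Continuous g)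
    {C : ℝ} (hC : ∀ v, |g v| ≤ C * (1 + ‖v‖ ^ 2)) {β : ℝ}
    (h : ∀ ε : ℝ, 0 < ε → ∃ τ : ℝ, 0 < τ ∧ ∃ N₀ : ℕ, ∀ N : ℕ, N₀ ≤ N →
      ∫⁻ z, ENNReal.ofReal (Real.exp (β * ∑ i : Fin (N + 1),
          (τ * ((N : ℝ) + 1) ^ (-(1 / 3 : ℝ)))⁻¹ *
            ∫ r in (0 : ℝ)..(τ * ((N : ℝ) + 1) ^ (-(1 / 3 : ℝ))), g (((Φ N).flow r z) i).2))
        ∂(localGibbsLaw σ (fun _ => a₀) (fun _ => 0) (fun _ => 1) N (Φ N)) ≤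
      ENNReal.ofReal (Real.exp (ε * ((N : ℝ) + 1))))
    {θ : ℝ} (hθ : 0 < θ) :
    β * ∫ v, g v ∂(gaussMeasure (0 : V3) θ) ≤ 3 / 2 * (θ - 1 - Real.log θ) := by
  by_contra hlt
  rw [not_le] at hlt
  set ε : ℝ := (β * ∫ v, g v ∂(gaussMeasure (0 : V3) θ) - 3 / 2 * (θ - 1 - Real.log θ)) / 2 with hεdef
  have hε : 0 < ε := by rw [hεdef]; linarith
  obtain ⟨τ, hτ, N₀, hN⟩ := h ε hε
  have hw : 0 < τ * ((N₀ : ℝ) + 1) ^ (-(1 / 3 : ℝ)) := mul_pos hτ (Real.rpow_pos_of_pos (by positivity) _)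
  have hfloor := shellFloor ha hσ2 N₀ (Φ N₀) hg hC β hθ hw
  have h2 := hfloor.trans (hN N₀ le_rfl)
  rw [ENNReal.ofReal_le_ofReal_iff (Real.exp_pos _).le, Real.exp_le_exp] at h2
  have hN1 : (0 : ℝ) < (N₀ : ℝ) + 1 := by positivity
  have : ((N₀ : ℝ) + 1) * (2 * ε) ≤ ε * ((N₀ : ℝ) + 1) := by
    have e2 : β * ∫ v, g v ∂(gaussMeasure (0 : V3) θ) - 3 / 2 * (θ - 1 - Real.log θ) = 2 * ε := by
      rw [hεdef]; ring
    rw [← e2]; exact h2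
  nlinarith

end Summit.AtomisticToContinuum.HydrodynamicLimit.Theorems.EquilibriumFastWindowLDNegative

end
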